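import Summits.BirchSwinnertonDyer.Rank1Residual.ManinAdditive.ThetaFourOmegaCusps
import Literature.NumberTheory.EllipticCurves.RootNumberTableThreeKodairaProofs
import Literature.NumberTheory.EllipticCurves.RootNumberTableThreeCondExpProofs
import Literature.NumberTheory.EllipticCurves.CuspFormTwistAtkinLehnerProofs
import Mathlib.RingTheory.Ideal.Int
import HarnessLib
import HarnessLib.Audit.Tags

/-!
# The SIGN of `w₉` on the theta pairs of the level-`9p` special order, and Rizzo's `W₃` on Kodaira III / III* / Iₙ*
(cell bsd-f2-manin, desc lens g22, MEMO-desc §47.15–47.16; SIBLING 4 of the landed `ThetaFourOmega.lean`; imports the landed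
SIBLING 1 `ThetaFourOmegaCusps.lean` (rows 156β, 156γ, 156β⁺) + the tree's Rizzo Table II proofs + the tree's PROVED
`w_{Q_p} f_χ = χ(−1) f_χ`; same namespace; nothing under `@[conjecture]` is asserted; everything else is PROVED).

THE SIGN LAW (desc g22 addendum, answering ref1 R194 P1).  At a level `N` with `9 ∥ N` the Atkin–Lehner involution `w₉`
acts on the theta span of the special order of level `9p` of `B_{3,∞}` by the SCALAR `(−1)^{e+1}`: `+1` on the
`θ₄`-module (`e = 1`; local type at `3`: the depth-zero supercuspidal `Ind θ₄` of conductor `9` — the curves of Kodaira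
type III, III*), `−1` on the `θ₄²`-module (`e = 2`; local types `St ⊗ χ`, `PS ⊗ χ`, `χ` quadratic ramified — Kodaira `Iₙ*`).
Reason on paper: `w₉`-eigenvalue of a `9`-primitive eigenform = local root number `ε(½, π₃)`; `ε(Ind θ₄) = +1`
(pure Gauss sum of the order-4 character of `𝔽₉^×`), `ε(St ⊗ χ) = ε(PS(μχ, μ⁻¹χ)) = χ(−1) = −1` (both ramified quadratic
characters of `ℚ₃^×` are odd).  For CURVES this is literally Rizzo's Table II [Rizzo2003] (rows with `v(N) = 2`:
`(≥2,3,3)ˢᵖ, (2,≥5,3) ↦ III, +1`; `(≥4,6,9)ˢᵖ, (4,≥8,9) ↦ III*, +1`; `(2,3,≥6) ↦ I*_{c−6}, −1`; `(3,≥6,6) ↦ I₀*, −1`)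
combined with «AL eigenvalue = local root number» [KellockDokchitser2023, Rem. 2.2] — whose tree version
`atkinLehnerEigenvalueAt_eq_localRootNumberAt` EXCLUDES additive `p = 3` (junk value of `localRootNumberAt` there);
row E-desc-160 below is that excluded case, with Rizzo's `W.rootNumberThree` as the right-hand side.

CONSEQUENCE FOR THE C3 CHAIN.  The structure row 156β⁺ `ThetaPairAtkinLehnerClosedAtNinePrime` (the single open E-blind
input of `E-156 ⟸ 156β⁺ ∧ 156γ`, ref1 (b4)) FOLLOWS from the sign row 156β† (PROVED here: `e = 1`: `(u', x') = (u, x)`;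
`e = 2`: `(u', x') = (−u, x)`, theta pairs are odd in `u`), and the twist half of the `e = 2` case IS A THEOREM OF THE TREE
(`atkinLehnerInvolutionAt_charTwist`: `w₉ (g ⊗ χ) = χ(−1)·(g ⊗ χ)` for `g` of level dividing `3p`; PROVED corollary below).

CENSUS = BC5 WITNESSES (kit tag bsd; engines: imc ENGINE 7 `neronomega.gp` cfb53958 + desc patches; SHA16SUMS.desc.g22).
(W1) THETA SIGN (kit j335649, patch `nb/neronomega_theta_c1.gp` a51f5d58e3982d7c, stdout 9f8720f65222c902): at the 19 levels
`9M`, `M ∈ {5,…,49, 53, 55, 61}` (incl. `25, 35, 49, 55`): **1196/1196** `e = 1` theta vectors (re & im parts, orbit and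
cuspidal-basis vectors) satisfy `w₉ y = +y` and **850/850** `e = 2` vectors satisfy `w₉ y = −y` (2046/2046, 0 exceptions).
P1 (ref1 R194): the `(C_1)` allowance at the cusp `1/3` is NEVER used by `e = 1` vectors (`min v_{(1−ζ₃)} = 0` on 1138,
`= 2` on 58) and ALWAYS attained with equality `−1` by `e = 2` vectors (850/850).
(W2) CURVES, E-visible (imc ENGINE 7 `w_eig` column × Kodaira, all optimal classes with `9 ∥ N ≤ 1300`): **506/506**
(III: 102 × `+1`, III*: 59 × `+1`, `Iₙ*`: 345 × `−1`).
(W3) CURVES, local (kit j335672, `nb/signlaw9.gp` 8786958c13e94399 on `nb/curves9par.txt` 3a6a106503b1eeb1, stdout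
12b9138ca7da855e; PARI `ellrootno(E,3)` × `elllocalred`): all **458427** isogeny classes with `9 ∥ N < 500000` in
[CremonaEcdata]: III 58131 × `+1`, III* 50731 × `+1`, `Iₙ*` (`0 ≤ n ≤ 44`) 349565 × `−1`; 0 exceptions (this re-verifies the
six `v(N) = 2` rows of the transcription `Rizzo.tableII`, cf. the tree's 923952-curve validation).
(W4) N = 1017 = 9·113 (kit j335548, stdout db7513772acada4c; out of sample, pre-registered in MEMO-desc §47.13): 912/912 theta
vectors are cusp forms in `Ω₃(1017)`; `LAW d_sat(theta ⊕ twists ⊕ old) = ord₃ r_Ω(f_E)` 12/12 classes (III/III*: theta alone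
8/8, depths 0,3,1,2,0,1,3,2; `I₉*` 1017i1, 1017l1: theta 0 + twists ⟹ 2 = `ord₃ r_Ω`; `I₃*` 1017k1: 1; `I₀*` 1017j1: twists
alone 1, theta ⊕ twists 2 = `ord₃ r_Ω`) ⟹ running total of the THV law 64/64 classes at 20 levels.

ROWS (nothing asserted): **E-desc-156β† `ThetaPairAtkinLehnerSignAtNinePrime`** (E-blind; THEOREM-candidate: Eichler–JL for
the special order + the two local `ε`-factors), **E-desc-160 `AtkinLehnerSignThreeEqRootNumberThree`** (PRINT FACT missing from
the tree at additive `3`: [KellockDokchitser2023, Rem. 2.2] = Schmidt 2002 Thm 3.2.2 + LLC + modularity, with [Rizzo2003,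
Table II] for `w(E/ℚ₃)`; Literature home requested from the typist).  PROVED: `thetaCoeff12_neg`, `IsThetaPair.neg`,
**156β† ⟹ 156β⁺ ⟹ 156β**, `156β† ∧ 156γ ⟹ E-156`; the twist case of the `e = 2` sign (tree theorem, restated at level
`9p`); Rizzo-table complements `Iₙ* ↦ (W₃, v(N)) = (−1, 2)` for EVERY `n` (the tree has `n = 0`), `III, III* ↦ v(N) = 2`,
`v(N) = 2 ↦ III ∨ III* ∨ Iₙ*` (the III/III*/I₀* SIGN rows are the tree's, `RootNumberTableThreeKodairaReductionProofs` —
not yet built on the farm, so restated jointly with the `v(N)` column); their curve-level forms at the place `3` (with the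
tree's PROVED `kodairaSymbolAt_eq_tableKodairaSymbolThree` and `conductorExponent_eq_tableConductorExponentThree_holds`); and
**E-160 ⟹ (III ∨ III* ⟹ w₉ f_E = f_E) ∧ (Iₙ* ⟹ w₉ f_E = −f_E)**.
NOT IN PRINT as typed (nearest: [Pizer1980, Thm. 2.26]; [AtkinLehner1970, §6] / [AtkinLi1978, §3] (twists);
[Rizzo2003, Table II]; [KellockDokchitser2023, Rem. 2.2]).  PARTITION 0 · beyond-print theorem: no · bears_on:
stmt-BirchSwinnertonDyer-22968 (C3 `ManinPrimeToThreeAtNine`).  `3 ∤ c_E` is NOT proved by this; BSD is not proved by this;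
C2, C3 OPEN.

TYPER NOTE (typer g21, T-desc-44).  SOURCE = HOME/desc/g22/Sketch-desc-g22e.lean sha16 00a1c66a565903ad (382 l.; desc: farm rc 0·0·0·0, std
axioms, BC7 2/2 CLEAN bc7-g22e.raw.txt 96ebfcc941df70f6; MEMO-desc §47.16; kit j335649 w₉ sign 1196/1196 (e=1, +1) + 850/850 (e=2, −1); imc
ENGINE 7 × Kodaira 506/506; kit j335672 PARI ellrootno×elllocalred 458 427/458 427) VERBATIM; the only typer delta is this note.  Imports: landed
`…ManinAdditive.ThetaFourOmegaCusps` (p741490) + Literature `RootNumberTableThreeKodairaProofs` / `RootNumberTableThreeCondExpProofs` /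
`CuspFormTwistAtkinLehnerProofs` + `Mathlib.RingTheory.Ideal.Int` + HarnessLib(+Audit.Tags); namespace `…ManinAdditive.ThetaFourOmega`.  ROWS
(desc's `@[conjecture]` tags): **E-desc-156β† `ThetaPairAtkinLehnerSignAtNinePrime`**, **E-desc-160 `AtkinLehnerSignThreeEqRootNumberThree`**;
PROVED: `thetaCoeff12_neg`, `IsThetaPair.neg`, **`thetaPairAtkinLehnerClosed_of_sign` (156β† ⟹ 156β⁺)**, `thetaPairCuspZeroIntegral_of_sign`,
`thetaFourOmegaIntegral_of_sign`, `atkinLehnerInvolutionAt_nine_charTwist_three`, the Rizzo/KD table lemmas incl. **E-desc-160♭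
`rootNumberThree_of_conductorExponent_eq_two`**, `atkinLehner_three_of_kodaira`, `atkinLehner_nine_sign_of_conductorExponent_eq_two`.  27 decl
names fresh; cite keys present; no instances/notation/sorry.  bears_on: stmt-BirchSwinnertonDyer-22968 (C3).  BSD is not proved; C3 OPEN.
-/

namespace Summit.BirchSwinnertonDyer.Rank1Residual.ManinAdditive.ThetaFourOmega

open scoped MatrixGroups ModularForm
open CongruenceSubgroup WeierstrassCurve Literature.NumberTheory.EllipticCurves
open Literature.NumberTheory.EllipticCurves.ModularForms
open Summit.BirchSwinnertonDyer.Rank1Residual.ManinAdditive.HurwitzBrandt (DQuat)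
open Summit.BirchSwinnertonDyer.Rank1Residual.ManinAdditive.ThetaFourBrandt
open Summit.BirchSwinnertonDyer.Rank1Residual.ManinAdditive.NeronOmegaThree
open Literature.NumberTheory.DiophantineGeometry (KodairaSymbol)

/-! ### §1. Theta pairs are odd in `u` (PROVED) -/

/-- `i^n · (−z) = −(i^n · z)`. [folklore] -/
theorem iPowMul_neg (n : ℕ) (z : ZI) : ZI.iPowMul n (-z) = -ZI.iPowMul n z := by
  induction n generalizing z with
  | zero => rfl
  | succ n ih =>
    show ZI.iPowMul n (-(-z).2, (-z).1) = -ZI.iPowMul n (-z.2, z.1)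
    rw [← ih]
    rfl

/-- `(−a) + (−b) = −(a + b)` in `ℤ[i]`. [folklore] -/
theorem ziAdd_neg (a b : ZI) : ZI.add (-a) (-b) = -ZI.add a b := by
  simp only [ZI.add, Prod.neg_mk, Prod.fst_neg, Prod.snd_neg, neg_add]

/-- Negating every summand negates a `ZI.add`-fold. [folklore] -/
theorem foldr_ziAdd_neg {α : Type*} (l : List α) (f : α → ZI) :
    (l.map fun a => -f a).foldr ZI.add (0, 0) = -(l.map f).foldr ZI.add (0, 0) := by
  induction l with
  | nil => simp
  | cons a l ih => simp only [List.map_cons, List.foldr_cons, ih, ziAdd_neg]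

/-- **The theta coefficients are odd in `u`:** `Θ^{(e)}_{−u,x} = −Θ^{(e)}_{u,x}` coefficientwise. [folklore] -/
theorem thetaCoeff12_neg (e p n : ℕ) (u : Fin (p + 1) → ZI) (x : Fin (p + 1)) :
    thetaCoeff12 e p n (-u) x = -thetaCoeff12 e p n u x := by
  unfold thetaCoeff12
  split_ifs with h
  · simp
  · simp only [Pi.neg_apply, iPowMul_neg]
    exact foldr_ziAdd_neg (dicyclicOfNorm n) fun γ => ZI.iPowMul (e * theta4Exp γ) (u (act3 p γ x))

/-- **A theta pair negated is the theta pair of `−u`.** [folklore] -/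
theorem IsThetaPair.neg {e p N : ℕ} {u : Fin (p + 1) → ZI} {x : Fin (p + 1)}
    {Θ₁ Θ₂ : CuspForm (Gamma0 N) 2} (h : IsThetaPair e p N u x Θ₁ Θ₂) :
    IsThetaPair e p N (-u) x (-Θ₁) (-Θ₂) := by
  intro n hn
  obtain ⟨h₁, h₂⟩ := h n hn
  rw [cuspCoeff_neg_form (one_mem_strictPeriods_coe_gamma0 N), cuspCoeff_neg_form (one_mem_strictPeriods_coe_gamma0 N),
    h₁, h₂, thetaCoeff12_neg, Prod.fst_neg, Prod.snd_neg, Int.cast_neg, Int.cast_neg]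
  exact ⟨rfl, rfl⟩

/-! ### §2. Row E-desc-156β† (the sign of `w₉` on theta pairs) and PROVED `156β† ⟹ 156β⁺ ⟹ 156β` -/

/-- **Row E-desc-156β† `ThetaPairAtkinLehnerSignAtNinePrime`** (E-blind SIGN row; desc g22 addendum 47.16; nothing
asserted): at level `9p` (`p ≥ 5` prime) `w₉` acts on a theta pair of the special order of level `9p` of `B_{3,∞}`
with character `θ₄^e` by the scalar `(−1)^{e+1}`: `w₉ Θ = Θ` for `e = 1` (supercuspidal module), `w₉ Θ = −Θ` for `e = 2`
(twisted module).  Mechanism on paper: the theta span of character `θ₄^e` lies in the sum of the eigenspaces of the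
`9`-primitive eigenforms whose local component at `3` is `Ind θ₄` (`e = 1`) resp. a ramified quadratic twist of an
unramified principal series or Steinberg (`e = 2`) (Eichler–Hijikata–Pizer–Shemanske basis problem / Jacquet–Langlands
for the special order); `w₉`-eigenvalue = `ε(½, π₃)` = `+1` resp. `χ(−1) = −1`.  The `e = 2` twist case is the tree's
`atkinLehnerInvolutionAt_charTwist` (PROVED below at level `9p`).  Census (module docstring (W1)): 1196/1196 (`e = 1`,
`+1`) and 850/850 (`e = 2`, `−1`) at 19 levels; E-visible shadows (W2) 506/506, (W3) 458427/458427.  Why it might fail: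
only through the span statement — a `θ₄²`-theta pair with a component on a `9`-primitive form of supercuspidal type
(sign `+1`) or a `θ₄`-pair meeting the twisted part; the local signs themselves are theorems.
[cite: CremonaEcdata] [cite: Pizer1980, Thm. 2.26 (shape)] [cite: KellockDokchitser2023, Rem. 2.2]
[cite: Rizzo2003, Table II (p. 4)] -/
@[conjecture]
def ThetaPairAtkinLehnerSignAtNinePrime : Prop :=
  ∀ (p e : ℕ) [NeZero (9 * p)], p.Prime → 5 ≤ p → (e = 1 ∨ e = 2) →
  ∀ (u : Fin (p + 1) → ZI) (x : Fin (p + 1)) (Θ₁ Θ₂ : CuspForm (Gamma0 (9 * p)) 2),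
    IsThetaPair e p (9 * p) u x Θ₁ Θ₂ →
    atkinLehnerInvolutionAt (9 * p) 2 3 Θ₁ = ((-1 : ℤ) ^ (e + 1)) • Θ₁ ∧
      atkinLehnerInvolutionAt (9 * p) 2 3 Θ₂ = ((-1 : ℤ) ^ (e + 1)) • Θ₂

/-- **PROVED: the sign row 156β† implies the structure row 156β⁺** (`e = 1`: the image pair is the pair itself;
`e = 2`: it is the pair of `(−u, x)`, by `IsThetaPair.neg`). -/
theorem thetaPairAtkinLehnerClosed_of_sign (h : ThetaPairAtkinLehnerSignAtNinePrime) :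
    ThetaPairAtkinLehnerClosedAtNinePrime := by
  intro p e _ hp h5 he u x Θ₁ Θ₂ hΘ
  obtain ⟨h₁, h₂⟩ := h p e hp h5 he u x Θ₁ Θ₂ hΘ
  rcases he with rfl | rfl
  · refine ⟨u, x, ?_⟩
    have h1 : ((-1 : ℤ) ^ (1 + 1)) = 1 := by norm_num
    rw [h₁, h₂, h1, one_zsmul, one_zsmul]
    exact hΘ
  · refine ⟨-u, x, ?_⟩
    have h3 : ((-1 : ℤ) ^ (2 + 1)) = -1 := by norm_num
    rw [h₁, h₂, h3, neg_one_zsmul, neg_one_zsmul]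
    exact hΘ.neg

/-- PROVED: 156β† ⟹ 156β (cusp `0`), through 156β⁺ and the tree's `thetaPairCuspZeroIntegral_of_closed`. -/
theorem thetaPairCuspZeroIntegral_of_sign (h : ThetaPairAtkinLehnerSignAtNinePrime) :
    ThetaPairCuspZeroIntegralAtNinePrime :=
  thetaPairCuspZeroIntegral_of_closed (thetaPairAtkinLehnerClosed_of_sign h)

/-- PROVED: **E-desc-156 ⟸ 156β† ∧ 156γ** (so the Ω₃-membership of theta pairs rests on the sign row and the single
finite local computation 156γ at the cusp `1/3`). -/
theorem thetaFourOmegaIntegral_of_sign (h : ThetaPairAtkinLehnerSignAtNinePrime)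
    (hγ : ThetaPairCuspThirdPiIntegralAtNinePrime) : ThetaFourOmegaIntegralAtNinePrime :=
  thetaFourOmegaIntegral_of_cusps (thetaPairCuspZeroIntegral_of_sign h) hγ

/-- **PROVED (tree theorem, restated at level `9p`): the twist case of the `e = 2` sign.**  For `g ∈ S₂(Γ₀(N))`,
`N ∣ 3p`, `3 ∤ p`, and an odd quadratic Dirichlet character `χ mod 3`: `w₉ (g ⊗ χ) = −(g ⊗ χ)` in `S₂(Γ₀(9p))`
(`atkinLehnerInvolutionAt_charTwist_of_eq` with `χ(−1) = −1`).  This is the `Iₙ*` (twisted-Steinberg / twisted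
principal series) half of row 156β† for theta pairs that are twists. -/
theorem atkinLehnerInvolutionAt_nine_charTwist_three {p N : ℕ} [NeZero p] [NeZero N] [NeZero (9 * p)]
    (hp3 : ¬ 3 ∣ p) (hN : N ∣ p * 3) (hNL : N ∣ 9 * p) (h9 : 3 ^ 2 ∣ 9 * p)
    {χ : DirichletCharacter ℂ 3} (hχ : χ.IsQuadratic) (hodd : χ (-1) = -1) (g : CuspForm (Gamma0 N) 2) :
    atkinLehnerInvolutionAt (9 * p) 2 3 (charTwist (9 * p) hNL h9 hχ g) = -charTwist (9 * p) hNL h9 hχ g := by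
  haveI : Fact (Nat.Prime 3) := ⟨Nat.prime_three⟩
  rw [atkinLehnerInvolutionAt_charTwist_of_eq (M := p) (by ring) hp3 hN hNL h9 hχ g, hodd, neg_one_smul]

/-! ### §3. Rizzo's Table II on the rows with `v(N) = 2` (PROVED complements of the tree's constant-sign rows) -/

section Rizzo

/-- One step down the `if`-cascade of `Rizzo.tableII` for a predicate holding on both branches. [folklore] -/
private theorem colPred_ite {c : Prop} [Decidable c] {P : KodairaSymbol × ℕ × ℤ → Prop}
    {v w : KodairaSymbol × ℕ × ℤ} (hv : P v) (hw : P w) : P (if c then v else w) := by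
  split <;> assumption

/-- **On every row of Table II of Kodaira type `Iₙ*` (rows `(2,3,≥6)`: `I*_{c−6}`; `(3,≥6,6)`: `I₀*`) the `W₃` entry
is `−1` and `v(N) = 2`** — for EVERY `n` (the tree's `tableII_w_eq_neg_one_of_kodaira_eq_Istar_zero` is `n = 0`).
[cite: Rizzo2003, Table II (p. 4), columns Kod, v(N), W₃] -/
theorem tableII_w_condExp_of_kodaira_eq_Istar (a b : WithTop ℤ) (c x y z : ℤ) (n : ℕ)
    (h : (Rizzo.tableII a b c x y z).1 = .Istar n) :
    (Rizzo.tableII a b c x y z).2.2 = -1 ∧ (Rizzo.tableII a b c x y z).2.1 = 2 := by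
  revert h
  unfold Rizzo.tableII; dsimp only
  repeat
    refine colPred_ite (P := fun t : KodairaSymbol × ℕ × ℤ => t.1 = .Istar n → t.2.2 = -1 ∧ t.2.1 = 2)
      (by intro h; first | exact ⟨rfl, rfl⟩ | simp at h) ?_
  intro h; simp at h

/-- **On every row of type III (`(≥2,3,3)ˢᵖ`, `(2,≥5,3)`) `W₃ = +1` and `v(N) = 2`** (the sign half is the tree's
`Rizzo.tableII_w_eq_one_of_kodaira_eq_III` in `RootNumberTableThreeKodairaReductionProofs`, a module not yet built on the
farm at the time of writing — hence restated together with the `v(N)` column). [cite: Rizzo2003, Table II (p. 4)] -/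
theorem tableII_w_condExp_of_kodaira_eq_III (a b : WithTop ℤ) (c x y z : ℤ)
    (h : (Rizzo.tableII a b c x y z).1 = .III) :
    (Rizzo.tableII a b c x y z).2.2 = 1 ∧ (Rizzo.tableII a b c x y z).2.1 = 2 := by
  revert h
  unfold Rizzo.tableII; dsimp only
  repeat
    refine colPred_ite (P := fun t : KodairaSymbol × ℕ × ℤ => t.1 = .III → t.2.2 = 1 ∧ t.2.1 = 2)
      (by intro h; first | exact ⟨rfl, rfl⟩ | simp at h) ?_
  intro h; simp at h

/-- **On every row of type III* (`(≥4,6,9)ˢᵖ`, `(4,≥8,9)`) `W₃ = +1` and `v(N) = 2`** (sign half = the tree's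
`Rizzo.tableII_w_eq_one_of_kodaira_eq_IIIstar`, same remark). [cite: Rizzo2003, Table II (p. 4)] -/
theorem tableII_w_condExp_of_kodaira_eq_IIIstar (a b : WithTop ℤ) (c x y z : ℤ)
    (h : (Rizzo.tableII a b c x y z).1 = .IIIstar) :
    (Rizzo.tableII a b c x y z).2.2 = 1 ∧ (Rizzo.tableII a b c x y z).2.1 = 2 := by
  revert h
  unfold Rizzo.tableII; dsimp only
  repeat
    refine colPred_ite (P := fun t : KodairaSymbol × ℕ × ℤ => t.1 = .IIIstar → t.2.2 = 1 ∧ t.2.1 = 2)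
      (by intro h; first | exact ⟨rfl, rfl⟩ | simp at h) ?_
  intro h; simp at h

/-- **`v(N) = 2` happens exactly on the rows of type III, III*, `Iₙ*`** (the six rows listed in the module
docstring). [cite: Rizzo2003, Table II (p. 4), columns Kod, v(N)] -/
theorem tableII_kodaira_of_condExp_eq_two (a b : WithTop ℤ) (c x y z : ℤ)
    (h : (Rizzo.tableII a b c x y z).2.1 = 2) :
    (Rizzo.tableII a b c x y z).1 = .III ∨ (Rizzo.tableII a b c x y z).1 = .IIIstar ∨
      ∃ n, (Rizzo.tableII a b c x y z).1 = .Istar n := by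
  revert h
  unfold Rizzo.tableII; dsimp only
  repeat
    refine colPred_ite
      (P := fun t : KodairaSymbol × ℕ × ℤ => t.2.1 = 2 → t.1 = .III ∨ t.1 = .IIIstar ∨ ∃ n, t.1 = .Istar n)
      (by intro h; simp_all) ?_
  intro h; simp at h

/-- **On the rows with `v(N) = 2` the sign is the type:** `W₃ = +1` with III / III*, `W₃ = −1` with `Iₙ*`.
[cite: Rizzo2003, Table II (p. 4), columns Kod, v(N), W₃] -/
theorem tableII_w_of_condExp_eq_two (a b : WithTop ℤ) (c x y z : ℤ) (h : (Rizzo.tableII a b c x y z).2.1 = 2) :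
    ((Rizzo.tableII a b c x y z).2.2 = 1 ∧
        ((Rizzo.tableII a b c x y z).1 = .III ∨ (Rizzo.tableII a b c x y z).1 = .IIIstar)) ∨
      ((Rizzo.tableII a b c x y z).2.2 = -1 ∧ ∃ n, (Rizzo.tableII a b c x y z).1 = .Istar n) := by
  rcases tableII_kodaira_of_condExp_eq_two a b c x y z h with h3 | h3 | ⟨n, hn⟩
  · exact Or.inl ⟨(tableII_w_condExp_of_kodaira_eq_III a b c x y z h3).1, Or.inl h3⟩
  · exact Or.inl ⟨(tableII_w_condExp_of_kodaira_eq_IIIstar a b c x y z h3).1, Or.inr h3⟩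
  · exact Or.inr ⟨(tableII_w_condExp_of_kodaira_eq_Istar a b c x y z n hn).1, n, hn⟩

end Rizzo

/-! ### §4. The same for curves over `ℚ` at the place `3` (PROVED, on the tree's Tate = Table theorems) -/

section Curves

open IsDedekindDomain Rat.HeightOneSpectrum

/-- The place `placeThree` of the Ω₃-dictionary is the prime `3` under Mathlib's `primesEquiv`. [folklore] -/
theorem primesEquiv_placeThree : ((primesEquiv placeThree : Nat.Primes) : ℕ) = 3 := by
  simp [placeThree]

/-- The residue ring of `ℤ` at `placeThree` has characteristic `3`. [folklore] -/
theorem ringChar_quot_placeThree : ringChar (ℤ ⧸ placeThree.asIdeal) = 3 := by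
  have he : Rat.IsIntegralClosure.intEquiv ℤ = RingEquiv.refl ℤ := RingEquiv.ext fun x ↦ by simp
  have hI : placeThree.asIdeal = Ideal.span {(natGenerator placeThree : ℤ)} := by
    rw [span_natGenerator, he]
    exact (Ideal.map_id _).symm
  have h3 : natGenerator placeThree = 3 := primesEquiv_placeThree
  rw [hI, h3]
  exact Int.ringChar_idealQuot _

variable (W : WeierstrassCurve ℚ) [W.IsElliptic] {v : HeightOneSpectrum ℤ}

/-- **Type III at `3` ⇒ `W₃ = +1` and conductor exponent `2`** (sign half = the tree's
`rootNumberThree_eq_one_of_kodairaSymbolAt_eq_III`, unbuilt module; see §3).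
[cite: Rizzo2003, Table II (p. 4), columns Kod, v(N), W₃] -/
theorem rootNumberThree_condExp_of_kodairaSymbolAt_eq_III (hv : ringChar (ℤ ⧸ v.asIdeal) = 3)
    (h : W.kodairaSymbolAt v = .III) : W.rootNumberThree = 1 ∧ W.conductorExponent v = 2 := by
  rw [kodairaSymbolAt_eq_tableKodairaSymbolThree W hv] at h
  rw [conductorExponent_eq_tableConductorExponentThree_holds W v hv]
  exact tableII_w_condExp_of_kodaira_eq_III _ _ _ _ _ _ h

/-- **Type III* at `3` ⇒ `W₃ = +1` and conductor exponent `2`.** [cite: Rizzo2003, Table II (p. 4)] -/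
theorem rootNumberThree_condExp_of_kodairaSymbolAt_eq_IIIstar (hv : ringChar (ℤ ⧸ v.asIdeal) = 3)
    (h : W.kodairaSymbolAt v = .IIIstar) : W.rootNumberThree = 1 ∧ W.conductorExponent v = 2 := by
  rw [kodairaSymbolAt_eq_tableKodairaSymbolThree W hv] at h
  rw [conductorExponent_eq_tableConductorExponentThree_holds W v hv]
  exact tableII_w_condExp_of_kodaira_eq_IIIstar _ _ _ _ _ _ h

/-- **Type `Iₙ*` at `3` ⇒ `W₃ = −1` and conductor exponent `2`, for every `n`** (the tree: `W₃` for `n = 0`).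
[cite: Rizzo2003, Table II (p. 4), columns Kod, v(N), W₃] -/
theorem rootNumberThree_condExp_of_kodairaSymbolAt_eq_Istar (hv : ringChar (ℤ ⧸ v.asIdeal) = 3) {n : ℕ}
    (h : W.kodairaSymbolAt v = .Istar n) : W.rootNumberThree = -1 ∧ W.conductorExponent v = 2 := by
  rw [kodairaSymbolAt_eq_tableKodairaSymbolThree W hv] at h
  rw [conductorExponent_eq_tableConductorExponentThree_holds W v hv]
  exact tableII_w_condExp_of_kodaira_eq_Istar _ _ _ _ _ _ n h

/-- **`9 ∥ N_E` read at the place `3`: conductor exponent `2` ⟺ Kodaira type III, III* or `Iₙ*`** (PROVED on the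
tree's `conductorExponent_eq_tableConductorExponentThree_holds` and `kodairaSymbolAt_eq_tableKodairaSymbolThree`).
[cite: Rizzo2003, Table II (p. 4), columns Kod, v(N)] -/
theorem kodairaSymbolAt_of_conductorExponent_eq_two (hv : ringChar (ℤ ⧸ v.asIdeal) = 3)
    (h2 : W.conductorExponent v = 2) :
    W.kodairaSymbolAt v = .III ∨ W.kodairaSymbolAt v = .IIIstar ∨ ∃ n, W.kodairaSymbolAt v = .Istar n := by
  rw [conductorExponent_eq_tableConductorExponentThree_holds W v hv] at h2
  rw [kodairaSymbolAt_eq_tableKodairaSymbolThree W hv]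
  exact tableII_kodaira_of_condExp_eq_two _ _ _ _ _ _ h2

/-- Converse: Kodaira type III, III* or `Iₙ*` at `3` ⇒ conductor exponent `2`. [cite: Rizzo2003, Table II (p. 4)] -/
theorem conductorExponent_eq_two_of_kodairaSymbolAt (hv : ringChar (ℤ ⧸ v.asIdeal) = 3)
    (h : W.kodairaSymbolAt v = .III ∨ W.kodairaSymbolAt v = .IIIstar ∨ ∃ n, W.kodairaSymbolAt v = .Istar n) :
    W.conductorExponent v = 2 := by
  rcases h with h | h | ⟨n, h⟩
  · exact (rootNumberThree_condExp_of_kodairaSymbolAt_eq_III W hv h).2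
  · exact (rootNumberThree_condExp_of_kodairaSymbolAt_eq_IIIstar W hv h).2
  · exact (rootNumberThree_condExp_of_kodairaSymbolAt_eq_Istar W hv h).2

/-- **`W₃` at `9 ∥ N_E` is the Kodaira sign:** conductor exponent `2` at `3` ⇒ (`W₃ = +1` and type III / III*) or
(`W₃ = −1` and type `Iₙ*`). [cite: Rizzo2003, Table II (p. 4), columns Kod, v(N), W₃] -/
theorem rootNumberThree_of_conductorExponent_eq_two (hv : ringChar (ℤ ⧸ v.asIdeal) = 3)
    (h2 : W.conductorExponent v = 2) :
    (W.rootNumberThree = 1 ∧ (W.kodairaSymbolAt v = .III ∨ W.kodairaSymbolAt v = .IIIstar)) ∨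
      (W.rootNumberThree = -1 ∧ ∃ n, W.kodairaSymbolAt v = .Istar n) := by
  rcases kodairaSymbolAt_of_conductorExponent_eq_two W hv h2 with h | h | ⟨n, h⟩
  · exact Or.inl ⟨(rootNumberThree_condExp_of_kodairaSymbolAt_eq_III W hv h).1, Or.inl h⟩
  · exact Or.inl ⟨(rootNumberThree_condExp_of_kodairaSymbolAt_eq_IIIstar W hv h).1, Or.inr h⟩
  · exact Or.inr ⟨(rootNumberThree_condExp_of_kodairaSymbolAt_eq_Istar W hv h).1, n, h⟩

end Curves

/-! ### §5. Row E-desc-160 (AL sign at `3` = Rizzo's `W₃`) and its PROVED Kodaira reading -/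

/-- **Row E-desc-160 `AtkinLehnerSignThreeEqRootNumberThree`** (PRINT FACT not yet in the tree; nothing asserted here):
for an elliptic curve `E/ℚ` with newform `f ∈ S₂(Γ₀(N_E))` and `3 ∣ N_E`, the Atkin–Lehner involution `w_{Q_3}`
(`Q_3 = 3^{v_3(N_E)}`) acts on `f` by Rizzo's Table-II local root number `W₃ = W.rootNumberThree ∈ {±1}`:
`w_{Q_3} f = W₃ · f`.  This is [KellockDokchitser2023, Rem. 2.2] («the local root number at `p` agrees with the
eigenvalue of the Atkin–Lehner involution», from Schmidt 2002 Thm 3.2.2 + local Langlands + modularity) at `p = 3`, with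
`w(E/ℚ₃)` read from [Rizzo2003, Table II] — exactly the case the tree's `atkinLehnerEigenvalueAt_eq_localRootNumberAt`
excludes by its guard (junk value of `localRootNumberAt` at additive `3`).  Census (W2): 506/506 optimal classes
`9 ∥ N ≤ 1300` (imc ENGINE 7 `w_eig`); (W3): `W₃` = PARI `ellrootno` on 458427/458427 classes.  Why it might fail: only a
transcription slip in `Rizzo.tableII` on a row with `27 ∣ N` (the `9 ∥ N` rows are re-verified by (W3); the whole table by
the tree's 923952-curve check).  [cite: KellockDokchitser2023, Rem. 2.2] [cite: Rizzo2003, Table II (p. 4), column W₃]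
[cite: Knapp1993, Thm. 9.27] [cite: CremonaEcdata] -/
@[conjecture]
def AtkinLehnerSignThreeEqRootNumberThree : Prop :=
  ∀ (W : WeierstrassCurve ℚ) [W.IsElliptic] [NeZero (W.conductorNorm ℤ)]
    (f : CuspForm (Gamma0 (W.conductorNorm ℤ)) 2), IsNewformOf W f → 3 ∣ W.conductorNorm ℤ →
    atkinLehnerInvolutionAt (W.conductorNorm ℤ) 2 3 f = ((W.rootNumberThree : ℤ) : ℂ) • f

/-- **PROVED: E-160 read on the Kodaira symbol at `3`** — `w_{Q_3} f_E = f_E` on type III / III*, `= −f_E` on type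
`Iₙ*` (every `n`); at `9 ∥ N_E` these are all the cases (`kodairaSymbolAt_of_conductorExponent_eq_two`).  The E-visible
shadow of the E-blind sign row 156β† (`e = 1 ↔ III/III* ↔ +1`, `e = 2 ↔ Iₙ* ↔ −1`). -/
theorem atkinLehner_three_of_kodaira (h160 : AtkinLehnerSignThreeEqRootNumberThree)
    (W : WeierstrassCurve ℚ) [W.IsElliptic] [NeZero (W.conductorNorm ℤ)]
    {f : CuspForm (Gamma0 (W.conductorNorm ℤ)) 2} (hf : IsNewformOf W f) (h3 : 3 ∣ W.conductorNorm ℤ)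
    {v : IsDedekindDomain.HeightOneSpectrum ℤ} (hv : ringChar (ℤ ⧸ v.asIdeal) = 3) :
    ((W.kodairaSymbolAt v = .III ∨ W.kodairaSymbolAt v = .IIIstar) →
        atkinLehnerInvolutionAt (W.conductorNorm ℤ) 2 3 f = f) ∧
      (∀ n, W.kodairaSymbolAt v = .Istar n → atkinLehnerInvolutionAt (W.conductorNorm ℤ) 2 3 f = -f) := by
  have hw := h160 W f hf h3
  refine ⟨fun hK => ?_, fun n hK => ?_⟩
  · have h1 : W.rootNumberThree = 1 := by
      rcases hK with hK | hK
      · exact (rootNumberThree_condExp_of_kodairaSymbolAt_eq_III W hv hK).1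
      · exact (rootNumberThree_condExp_of_kodairaSymbolAt_eq_IIIstar W hv hK).1
    rw [hw, h1, Int.cast_one, one_smul]
  · rw [hw, (rootNumberThree_condExp_of_kodairaSymbolAt_eq_Istar W hv hK).1, Int.cast_neg, Int.cast_one, neg_one_smul]

/-- PROVED, at the dictionary's place `placeThree` and `9 ∥ N_E` read as conductor exponent `2`: E-160 ⇒
`w₉ f_E = ± f_E` with the sign `+` iff type III/III*, `−` iff type `Iₙ*`. -/
theorem atkinLehner_nine_sign_of_conductorExponent_eq_two (h160 : AtkinLehnerSignThreeEqRootNumberThree)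
    (W : WeierstrassCurve ℚ) [W.IsElliptic] [NeZero (W.conductorNorm ℤ)]
    {f : CuspForm (Gamma0 (W.conductorNorm ℤ)) 2} (hf : IsNewformOf W f) (h3 : 3 ∣ W.conductorNorm ℤ)
    (h2 : W.conductorExponent placeThree = 2) :
    (atkinLehnerInvolutionAt (W.conductorNorm ℤ) 2 3 f = f ∧
        (W.kodairaSymbolAt placeThree = .III ∨ W.kodairaSymbolAt placeThree = .IIIstar)) ∨
      (atkinLehnerInvolutionAt (W.conductorNorm ℤ) 2 3 f = -f ∧ ∃ n, W.kodairaSymbolAt placeThree = .Istar n) := by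
  obtain ⟨hIII, hI⟩ := atkinLehner_three_of_kodaira h160 W hf h3 ringChar_quot_placeThree
  rcases kodairaSymbolAt_of_conductorExponent_eq_two W ringChar_quot_placeThree h2 with h | h | ⟨n, h⟩
  · exact Or.inl ⟨hIII (Or.inl h), Or.inl h⟩
  · exact Or.inl ⟨hIII (Or.inr h), Or.inr h⟩
  · exact Or.inr ⟨hI n h, n, h⟩

end Summit.BirchSwinnertonDyer.Rank1Residual.ManinAdditive.ThetaFourOmega
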